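import Mathlib
import HarnessLib
import Summits.QuantumFields.YangMills.Theorems.MirrorModularBoostsHypercubicLimitCouplingResponseDefsC
import Summits.QuantumFields.YangMills.Theorems.ScalingWindowSplitSelfNormalisedMomentBoundsRStubAssembly
import Literature.MathematicalPhysics.QuantumLattice.SchwartzReIm

/-!
# Crux `SelfNormalisedMomentBoundsR` (stmt-QuantumFields-18014), line `Sketch` — RESHAPED assembly `stub_assemblySlack`

The discrete phase-cell assembly of line `Sketch` (landed as `stub_assembly`, p161368) RE-RUN for the RESHAPED physics
stub of the line: the functional-graph cluster bound with the per-leg kernel `(a_k d_torus)⁻⁴ · (1 + a_k d_torus)` (a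
long-distance SLACK of one power) instead of the pure `(a_k d_torus)⁻⁴`.  Reason for the reshape (crux disprover
`cdisprove-…-18014-g2`, evidence `stub_clusterBound.md`, stub-misstated): for an asymptotically free `G` along deep-UV
admissible schemes the normalised plaquette covariance at physical distance `R` is `≍ (g_R/g_1)⁴ R⁻⁸` with the infrared
running `(g_R/g_1)⁴` unbounded in `k` (`≍ log ξ_phys,k` along `R = ξ_phys^{1-ε_k}`), so no `k`-uniform constant fits the
pure kernel at LONG distance, while the slack form has room to spare (`(g_R/g_1)⁴ ≤ 4` for `R ≤ ξ^{1/2}`, `≪ R²` beyond).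
The assembly pays for the slack with NO extra Schwartz order: the kernel enters only the per-vertex bound, and for
`a d ≥ 1` the slackened leg is `≤ 2 (a d)⁻³ ≤ 2` against `√|F| ≤ 1`, for `a d ≤ 1` the slack is `≤ 2` against the landed
vertex bound `√|Fᵢ(a xᵢ)| (a d)⁻⁴ ≤ 2^{4N+8}` — so the constants are those of `stub_assembly` with `V ↦ 2V`.
Everything else (A1 `stub_expansion`, A4 `stub_riemannSqrt`, the count `nⁿ ≤ 3ⁿ n!`) is reused verbatim.
References: Glimm–Jaffe, *Quantum Physics* (1987) §18; Osterwalder–Schrader II, CMP 42 (1975) §2.  No definitions.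
-/

noncomputable section

open scoped SchwartzMap BigOperators Topology
open MeasureTheory Filter Topology
open Literature.MathematicalPhysics.AQFT Literature.MathematicalPhysics.QuantumLattice
open Literature.MathematicalPhysics.QuantumFieldTheory Literature.Probability.LatticeModels
open Summit.QuantumFields.YangMills.Cruxes.HypercubicLimit.CouplingResponse

namespace Summit.QuantumFields.YangMills.Theorems.ScalingWindowSplit.SelfNormalisedMomentBoundsR

/-- **Registered stub `stub_assemblySlack` (line `Sketch`, reshaped; PROVED here from the pieces A1 `stub_expansion`, A2
`stub_vertexBound`, A4 `stub_riemannSqrt`).**  Given pointwise flatness and the Riemann bound, for every volume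
exponent `N` there are a Schwartz order `s` and a constant `K > 0` such that: for every scheme `S` and step `k`
with `a_k ≤ 1 ≤ a_k L_k`, `a_k⁻¹ ≤ (a_k L_k)^N`, vanishing one-point functions of the plane fields and the
SLACKENED functional-graph cluster bound (per-leg kernel `(a d)⁻⁴ (1 + a d)`) with constant `C ≥ 1` at the `n ≥ 2`
distinct-site level, every family of `n`
normalised (`normP s ≤ 1`), pairwise plane-wise disjointly supported 6-tuples has
`|∫ ∏ᵢ Φ^P_k(Fᵢ) dμ_k| ≤ K (K C)ⁿ n!`.  Proof: `n = 0` by normalisation, `n = 1` by the one-point identity; for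
`n ≥ 2` expand (A1), bound each injective term by the cluster bound, write every vertex factor as
`a⁴√|Fᵢ| · (√|Fᵢ| · kernel · slack)` and bound the second factor by `2 · 2^{4N+8}` (A2 when `a d ≤ 1`, where the slack is
`≤ 2`; `√|Fᵢ| ≤ 1` and `(a d)⁻⁴(1 + a d) ≤ 2` when `a d ≥ 1`; a vanishing value kills the whole term, otherwise disjointness
makes `xᵢ ≠ x_{f i}`), factorise the remaining sum over assignments into `∏ᵢ Σ_{q,x} a⁴√|Fᵢ^q(a x)|
≤ (6·2⁸K)ⁿ` (A4), and count the `nⁿ ≤ 3ⁿ n!` maps `f`. [folklore] -/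
theorem stub_assemblySlack :
    (∀ (M : ℕ) (f : 𝓢(EuclideanSpace ℝ (Fin 4), ℝ)) (y z : EuclideanSpace ℝ (Fin 4)),
      z ∉ tsupport (f : EuclideanSpace ℝ (Fin 4) → ℝ) →
      |f y| ≤ SchwartzMap.seminorm ℝ 0 M f * ‖y - z‖ ^ M) →
    (∃ K : ℝ, ∀ (a : ℝ), 0 < a → a ≤ 1 → ∀ (c : EuclideanSpace ℝ (Fin 4)) (Λ : Finset (Site 4)),
      a ^ 4 * ∑ x ∈ Λ, ((1 + ‖a • siteToE x - c‖)⁻¹) ^ 8 ≤ K) →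
    ∀ N : ℕ, ∃ (s : ℕ) (K : ℝ), 0 < K ∧
      ∀ (G : Type) [Group G] [TopologicalSpace G] [IsTopologicalGroup G] [CompactSpace G] [MeasurableSpace G]
        [BorelSpace G] (r : LatticeRep G) (S : SpeciesScheme (YMSpecies G)) (k : ℕ) (C : ℝ),
        1 ≤ C → S.a k ≤ 1 → 1 ≤ S.a k * (S.L k : ℝ) → (S.a k)⁻¹ ≤ (S.a k * (S.L k : ℝ)) ^ N →
        (∀ (q : Plane) (f : 𝓢(EuclideanSpace ℝ (Fin 4), ℝ)), ∫ U, planeField r S k q f U ∂(wilsonAt r S k) = 0) →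
        (∀ (n : ℕ) (x : Fin n → Site 4) (q : Fin n → Plane), 2 ≤ n → Function.Injective x →
          (∀ i, x i ∈ box 4 (S.L k)) →
          |S.c r.curvature k ^ n *
              ∫ U, ∏ i, ((planeSpecies r (q i)).F (configShift (-(x i)) (torusLift (S.side k) U)) -
                S.m r.curvature k / 6) ∂(wilsonAt r S k)| ≤
            C ^ n * ∑ f : Fin n → Fin n, (if ∀ i, f i ≠ i then
              ∏ i, (((S.a k * ‖siteToE (fun μ : Fin 4 =>
                ((((x i μ - x (f i) μ : ℤ) : ZMod (S.side k)).valMinAbs : ℤ)))‖)⁻¹) ^ 4 *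
                (1 + S.a k * ‖siteToE (fun μ : Fin 4 =>
                  ((((x i μ - x (f i) μ : ℤ) : ZMod (S.side k)).valMinAbs : ℤ)))‖)) else 0)) →
        ∀ (n : ℕ) (F : Fin n → Plane → 𝓢(EuclideanSpace ℝ (Fin 4), ℝ)),
          (∀ i, normP s (F i) ≤ 1) → (∀ i j, i ≠ j → DisjP (F i) (F j)) →
          |∫ U, ∏ i, fieldP r S k (F i) U ∂(wilsonAt r S k)| ≤ K * (K * C) ^ n * n.factorial := by
  intro hflat hR N
  obtain ⟨K_R, hKR⟩ := hR
  -- the Riemann constant made `≥ 1`, the vertex constant, the per-index constant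
  set K' : ℝ := max K_R 1 with hK'
  have hKR' : ∀ (a : ℝ), 0 < a → a ≤ 1 → ∀ (c : EuclideanSpace ℝ (Fin 4)) (Λ : Finset (Site 4)),
      a ^ 4 * ∑ x ∈ Λ, ((1 + ‖a • siteToE x - c‖)⁻¹) ^ 8 ≤ K' :=
    fun a ha ha1 c Λ => (hKR a ha ha1 c Λ).trans (le_max_left _ _)
  set V : ℝ := 2 ^ (4 * N + 8) * 2 with hV
  set R : ℝ := (Fintype.card Plane : ℝ) * (2 ^ 8 * K') with hR_def
  have hK'1 : 1 ≤ K' := le_max_right _ _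
  have hV1 : 1 ≤ V := by
    have : (1 : ℝ) ≤ 2 ^ (4 * N + 8) := one_le_pow₀ (by norm_num)
    rw [hV]; linarith
  have hR1 : 1 ≤ R := by
    have hc : (1 : ℝ) ≤ Fintype.card Plane := by
      exact_mod_cast Fintype.card_pos_iff.2 ⟨(⟨((0 : Fin 4), (1 : Fin 4)), by decide⟩ : Plane)⟩
    rw [hR_def]; nlinarith
  have hVR1 : 1 ≤ 3 * V * R := by nlinarith
  refine ⟨8 * N + 16, 3 * V * R, by positivity, ?_⟩
  intro G _ _ _ _ _ _ r S k C hC1 ha1 haL hpv h1 hcl n F hF hD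
  haveI : IsProbabilityMeasure (wilsonAt r S k) :=
    isProbabilityMeasure_wilsonMeasure (d := 4) (L := S.side k) r.ρ r.continuous (S.β k)
  have ha0 : 0 < S.a k := S.a_pos k
  have hKC : 0 ≤ 3 * V * R * C := by nlinarith
  -- `n = 0`, `n = 1`, `n ≥ 2`
  rcases Nat.lt_or_ge n 2 with hn | hn2
  · interval_cases n
    · simp only   [Finset.univ_eq_empty, Finset.prod_empty, integral_const, smul_eq_mul, mul_one, pow_zero,
        Nat.factorial_zero, Nat.cast_one, Measure.real, measure_univ, ENNReal.toReal_one, abs_one]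
      exact hVR1
    · have h0 : ∫ U, ∏ i : Fin 1, fieldP r S k (F i) U ∂(wilsonAt r S k) = 0 := by
        simp only [Fin.prod_univ_one]
        rw [Summit.QuantumFields.YangMills.Theorems.WeakCouplingHypercubicLimit.TraceNormColdPressure.integral_fieldP_eq_sum]
        exact Finset.sum_eq_zero fun q _ => h1 q (F 0 q)
      rw [h0, abs_zero]
      positivity
  · -- the main case `n ≥ 2`
    set a : ℝ := S.a k with ha_def
    set T : Finset (Plane × Site 4) := (Finset.univ : Finset Plane) ×ˢ box 4 (S.L k) with hT_def
    -- unit seminorms of every component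
    have hs8 : ∀ i q, SchwartzMap.seminorm ℝ 0 8 (F i q) ≤ 1 := fun i q =>
      seminorm_le_one_of_normP (hF i) q (by omega) (by omega)
    have hs0 : ∀ i q, SchwartzMap.seminorm ℝ 0 0 (F i q) ≤ 1 := fun i q =>
      seminorm_le_one_of_normP (hF i) q (by omega) (by omega)
    have hsN : ∀ i q, SchwartzMap.seminorm ℝ (8 * N + 8) 0 (F i q) ≤ 1 := fun i q =>
      seminorm_le_one_of_normP (hF i) q (by omega) (by omega)
    have hs16 : ∀ i q, SchwartzMap.seminorm ℝ 16 0 (F i q) ≤ 1 := fun i q =>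
      seminorm_le_one_of_normP (hF i) q (by omega) (by omega)
    -- the weight, the kernel
    set φ : (Fin n → Plane × Site 4) → Fin n → ℝ := fun g i => |F i (g i).1 (a • siteToE (g i).2)| with hφ_def
    set Kk : (Fin n → Plane × Site 4) → (Fin n → Fin n) → Fin n → ℝ := fun g f i =>
      ((a * ‖siteToE (fun μ : Fin 4 =>
        (((((g i).2 μ - (g (f i)).2 μ : ℤ) : ZMod (S.side k)).valMinAbs : ℤ)))‖)⁻¹) ^ 4 *
        (1 + a * ‖siteToE (fun μ : Fin 4 =>
          (((((g i).2 μ - (g (f i)).2 μ : ℤ) : ZMod (S.side k)).valMinAbs : ℤ)))‖) with hKk_def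
    have hφ0 : ∀ g i, 0 ≤ φ g i := fun g i => abs_nonneg _
    have hKk0 : ∀ g f i, 0 ≤ Kk g f i := fun g f i =>
      mul_nonneg (pow_nonneg (inv_nonneg.2 (mul_nonneg ha0.le (norm_nonneg _))) 4)
        (add_nonneg zero_le_one (mul_nonneg ha0.le (norm_nonneg _)))
    have hW0 : ∀ g : Fin n → Plane × Site 4, 0 ≤ ∏ i, a ^ 4 * φ g i := fun g =>
      Finset.prod_nonneg fun i _ => mul_nonneg (pow_nonneg ha0.le 4) (hφ0 g i)
    have hbox : ∀ g ∈ Fintype.piFinset (fun _ : Fin n => T), ∀ i, (g i).2 ∈ box 4 (S.L k) := fun g hg i =>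
      (Finset.mem_product.1 (Fintype.mem_piFinset.1 hg i)).2
    -- Step 1: expansion over lattice points (A1)
    have step1 := stub_expansion G r S k n F hD
    -- Step 2: the cluster bound, term by term
    have step2 : ∀ g ∈ Fintype.piFinset (fun _ : Fin n => T),
        (∏ i, a ^ 4 * φ g i) *
            (if Function.Injective (fun i => (g i).2) then
              |S.c r.curvature k ^ n *
                ∫ U, ∏ i, ((planeSpecies r (g i).1).F (configShift (-(g i).2) (torusLift (S.side k) U)) -
                  S.m r.curvature k / 6) ∂(wilsonAt r S k)|
            else 0) ≤
          (∏ i, a ^ 4 * φ g i) * (C ^ n * ∑ f : Fin n → Fin n, if ∀ i, f i ≠ i then ∏ i, Kk g f i else 0) := by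
      intro g hg
      refine mul_le_mul_of_nonneg_left ?_ (hW0 g)
      split_ifs with hinj
      · exact hcl n (fun i => (g i).2) (fun i => (g i).1) hn2 hinj (hbox g hg)
      · exact mul_nonneg (pow_nonneg (by linarith) n) (Finset.sum_nonneg fun f _ => by
          split_ifs
          · exact Finset.prod_nonneg fun i _ => hKk0 g f i
          · exact le_rfl)
    -- Step 3: the per-map bound `Σ_g W(g) ∏ Kk ≤ (V R)ⁿ` for a fixed-point-free `f`
    have step3 : ∀ f : Fin n → Fin n, (∀ i, f i ≠ i) →
        ∑ g ∈ Fintype.piFinset (fun _ : Fin n => T), (∏ i, a ^ 4 * φ g i) * ∏ i, Kk g f i ≤ (V * R) ^ n := by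
      intro f hf
      -- per assignment: `W(g) ∏ Kk ≤ Vⁿ ∏ a⁴ √φ`
      have hper : ∀ g ∈ Fintype.piFinset (fun _ : Fin n => T),
          (∏ i, a ^ 4 * φ g i) * ∏ i, Kk g f i ≤ V ^ n * ∏ i, a ^ 4 * Real.sqrt (φ g i) := by
        intro g hg
        rw [← Finset.prod_mul_distrib]
        by_cases hz : ∃ j, φ g j = 0
        · obtain ⟨j, hj⟩ := hz
          rw [Finset.prod_eq_zero (Finset.mem_univ j) (by rw [hj]; ring)]
          exact mul_nonneg (pow_nonneg (by positivity) n)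
            (Finset.prod_nonneg fun i _ => mul_nonneg (pow_nonneg ha0.le 4) (Real.sqrt_nonneg _))
        · push Not at hz
          calc ∏ i, a ^ 4 * φ g i * Kk g f i = ∏ i, (a ^ 4 * Real.sqrt (φ g i)) * (Real.sqrt (φ g i) * Kk g f i) := by
                refine Finset.prod_congr rfl fun i _ => ?_
                have := Real.mul_self_sqrt (hφ0 g i)
                calc a ^ 4 * φ g i * Kk g f i = a ^ 4 * (Real.sqrt (φ g i) * Real.sqrt (φ g i)) * Kk g f i := by
                      rw [this]
                  _ = _ := by ring
            _ ≤ ∏ i, (a ^ 4 * Real.sqrt (φ g i)) * V := by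
                refine Finset.prod_le_prod (fun i _ => mul_nonneg (mul_nonneg (pow_nonneg ha0.le 4)
                  (Real.sqrt_nonneg _)) (mul_nonneg (Real.sqrt_nonneg _) (hKk0 g f i))) fun i _ => ?_
                refine mul_le_mul_of_nonneg_left ?_ (mul_nonneg (pow_nonneg ha0.le 4) (Real.sqrt_nonneg _))
                -- the vertex bound (A2) at `x = (g i).2`, `w = (g (f i)).2`
                have hgw : F (f i) (g (f i)).1 (a • siteToE (g (f i)).2) ≠ 0 := abs_ne_zero.1 (hz (f i))
                have hne : (g i).2 ≠ (g (f i)).2 := by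
                  intro heq
                  have h1' : a • siteToE (g i).2 ∈ tsupport (F i (g i).1 : EuclideanSpace ℝ (Fin 4) → ℝ) :=
                    subset_tsupport _ (Function.mem_support.2 (abs_ne_zero.1 (hz i)))
                  have h2' : a • siteToE (g i).2 ∈
                      tsupport (F (f i) (g (f i)).1 : EuclideanSpace ℝ (Fin 4) → ℝ) := by
                    rw [heq]; exact subset_tsupport _ (Function.mem_support.2 hgw)
                  exact Set.disjoint_left.1 (hD i (f i) (hf i).symm (g i).1 (g (f i)).1) h1' h2'
                have hvb : Real.sqrt (φ g i) * ((a * ‖siteToE (fun μ : Fin 4 =>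
                    (((((g i).2 μ - (g (f i)).2 μ : ℤ) : ZMod (S.side k)).valMinAbs : ℤ)))‖)⁻¹) ^ 4 ≤
                    2 ^ (4 * N + 8) :=
                  stub_vertexBound hflat N (S.L k) a ha0 ha1 haL hpv (F i (g i).1) (F (f i) (g (f i)).1)
                    (g i).2 (g (f i)).2 (hbox g hg i) (hbox g hg (f i)) hne
                    (hD i (f i) (hf i).symm (g i).1 (g (f i)).1) hgw (hs8 i _) (hs0 i _) (hsN i _)
                -- the slack: `a d ≥ 1` ⇒ leg `≤ 2 (a d)⁻³ ≤ 2` and `√φ ≤ 1`; `a d ≤ 1` ⇒ slack `≤ 2`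
                have hsq1 : Real.sqrt (φ g i) ≤ 1 := by
                  refine Real.sqrt_le_one.2 ?_
                  have hns := SchwartzMap.norm_le_seminorm ℝ (F i (g i).1) (a • siteToE (g i).2)
                  rw [Real.norm_eq_abs] at hns
                  exact hns.trans (hs0 i _)
                simp only [hKk_def]
                generalize ht : a * ‖siteToE (fun μ : Fin 4 =>
                  (((((g i).2 μ - (g (f i)).2 μ : ℤ) : ZMod (S.side k)).valMinAbs : ℤ)))‖ = t at hvb ⊢
                have ht0 : 0 ≤ t := by rw [← ht]; exact mul_nonneg ha0.le (norm_nonneg _)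
                by_cases h1t : 1 ≤ t
                · have htpos : 0 < t := by linarith
                  have h4 : t ≤ t ^ 4 := by
                    calc t = t ^ 1 := (pow_one t).symm
                      _ ≤ t ^ 4 := pow_le_pow_right₀ h1t (by norm_num)
                  have hleg : (t⁻¹) ^ 4 * (1 + t) ≤ 2 := by
                    rw [inv_pow, inv_mul_le_iff₀ (pow_pos htpos 4)]
                    linarith
                  calc Real.sqrt (φ g i) * ((t⁻¹) ^ 4 * (1 + t)) ≤ 1 * 2 :=
                        mul_le_mul hsq1 hleg (mul_nonneg (pow_nonneg (inv_nonneg.2 ht0) 4) (by linarith))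
                          zero_le_one
                    _ ≤ V := by
                        have : (1 : ℝ) ≤ 2 ^ (4 * N + 8) := one_le_pow₀ (by norm_num)
                        rw [hV]; linarith
                · push Not at h1t
                  calc Real.sqrt (φ g i) * ((t⁻¹) ^ 4 * (1 + t))
                        = Real.sqrt (φ g i) * (t⁻¹) ^ 4 * (1 + t) := by ring
                    _ ≤ 2 ^ (4 * N + 8) * 2 :=
                        mul_le_mul hvb (by linarith) (by linarith) (by positivity)
                    _ = V := by rw [hV]
            _ = V ^ n * ∏ i, a ^ 4 * Real.sqrt (φ g i) := by
                rw [Finset.prod_mul_distrib, Finset.prod_const, Finset.card_univ, Fintype.card_fin, mul_comm]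
      -- sum over assignments: factorise and use the Riemann bound (A4)
      have hsumR : ∑ g ∈ Fintype.piFinset (fun _ : Fin n => T), ∏ i, a ^ 4 * Real.sqrt (φ g i) ≤ R ^ n := by
        have hfac : ∑ g ∈ Fintype.piFinset (fun _ : Fin n => T), ∏ i, a ^ 4 * Real.sqrt (φ g i) =
            ∏ i : Fin n, ∑ p ∈ T, a ^ 4 * Real.sqrt |F i p.1 (a • siteToE p.2)| :=
          (Finset.prod_univ_sum (fun _ : Fin n => T) fun i p => a ^ 4 * Real.sqrt |F i p.1 (a • siteToE p.2)|).symm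
        have hone : ∀ i : Fin n, ∑ p ∈ T, a ^ 4 * Real.sqrt |F i p.1 (a • siteToE p.2)| ≤ R := by
          intro i
          rw [hT_def, Finset.sum_product]
          calc ∑ q : Plane, ∑ x ∈ box 4 (S.L k), a ^ 4 * Real.sqrt |F i (q, x).1 (a • siteToE (q, x).2)|
              ≤ ∑ _q : Plane, 2 ^ 8 * K' := Finset.sum_le_sum fun q _ =>
                stub_riemannSqrt K' hKR' a ha0 ha1 (F i q) (hs0 i q) (hs16 i q) (box 4 (S.L k))
            _ = R := by rw [Finset.sum_const, Finset.card_univ, nsmul_eq_mul, hR_def]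
        rw [hfac]
        calc ∏ i : Fin n, ∑ p ∈ T, a ^ 4 * Real.sqrt |F i p.1 (a • siteToE p.2)|
            ≤ ∏ _i : Fin n, R := Finset.prod_le_prod (fun i _ => Finset.sum_nonneg fun p _ =>
              mul_nonneg (pow_nonneg ha0.le 4) (Real.sqrt_nonneg _)) fun i _ => hone i
          _ = R ^ n := by rw [Finset.prod_const, Finset.card_univ, Fintype.card_fin]
      calc ∑ g ∈ Fintype.piFinset (fun _ : Fin n => T), (∏ i, a ^ 4 * φ g i) * ∏ i, Kk g f i
          ≤ ∑ g ∈ Fintype.piFinset (fun _ : Fin n => T), V ^ n * ∏ i, a ^ 4 * Real.sqrt (φ g i) :=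
            Finset.sum_le_sum hper
        _ = V ^ n * ∑ g ∈ Fintype.piFinset (fun _ : Fin n => T), ∏ i, a ^ 4 * Real.sqrt (φ g i) := by
            rw [Finset.mul_sum]
        _ ≤ V ^ n * R ^ n := mul_le_mul_of_nonneg_left hsumR (pow_nonneg (by positivity) n)
        _ = (V * R) ^ n := (mul_pow V R n).symm
    -- Step 4: assemble
    have hVR0 : 0 ≤ V * R := by positivity
    calc |∫ U, ∏ i, fieldP r S k (F i) U ∂(wilsonAt r S k)|
        ≤ ∑ g ∈ Fintype.piFinset (fun _ : Fin n => T), (∏ i, a ^ 4 * φ g i) *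
            (C ^ n * ∑ f : Fin n → Fin n, if ∀ i, f i ≠ i then ∏ i, Kk g f i else 0) :=
          step1.trans (Finset.sum_le_sum step2)
      _ = C ^ n * ∑ f : Fin n → Fin n, ∑ g ∈ Fintype.piFinset (fun _ : Fin n => T),
            (∏ i, a ^ 4 * φ g i) * (if ∀ i, f i ≠ i then ∏ i, Kk g f i else 0) := by
          simp only [Finset.mul_sum]
          rw [Finset.sum_comm]
          refine Finset.sum_congr rfl fun f _ => Finset.sum_congr rfl fun g _ => ?_
          ring
      _ ≤ C ^ n * ∑ _f : Fin n → Fin n, (V * R) ^ n := by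
          refine mul_le_mul_of_nonneg_left (Finset.sum_le_sum fun f _ => ?_) (pow_nonneg (by linarith) n)
          by_cases hf : ∀ i, f i ≠ i
          · simp only [if_pos hf]
            exact step3 f hf
          · simp only [if_neg hf, mul_zero, Finset.sum_const_zero]
            exact pow_nonneg hVR0 n
      _ = C ^ n * ((n : ℝ) ^ n * (V * R) ^ n) := by
          rw [Finset.sum_const, Finset.card_univ, Fintype.card_fun, Fintype.card_fin, nsmul_eq_mul]
          push_cast
          ring
      _ ≤ C ^ n * ((3 : ℝ) ^ n * n.factorial * (V * R) ^ n) :=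
          mul_le_mul_of_nonneg_left (mul_le_mul_of_nonneg_right (pow_self_le_three_pow_mul_factorial n)
            (pow_nonneg hVR0 n)) (pow_nonneg (by linarith) n)
      _ = (3 * V * R * C) ^ n * n.factorial := by ring
      _ ≤ (3 * V * R) * ((3 * V * R * C) ^ n * n.factorial) :=
          le_mul_of_one_le_left (mul_nonneg (pow_nonneg hKC n) (Nat.cast_nonneg _)) hVR1
      _ = 3 * V * R * (3 * V * R * C) ^ n * n.factorial := by ring

end Summit.QuantumFields.YangMills.Theorems.ScalingWindowSplit.SelfNormalisedMomentBoundsR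

end
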